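import Literature.AnabelianGeometry.EtaleTheta.SettingModelChiSectionPoints
import Literature.AnabelianGeometry.EtaleTheta.SettingModelKummerCocycleContinuous
import HarnessLib

/-!
# The χ-twisted root model of [EtTh] §1 (R78 (B)), file F7b part C: ANCHORED points of `Ÿ(K̈)` at `modelχ`
# — the anchor `log(Ü)|_y = Ü(y)` at the `κ_u²`-twisted Galois sections (Def. 1.9's `τ^{±1}` shape)

S. Mochizuki, *The étale theta function and its Frobenioid-theoretic manifestations*, Publ. RIMS **45** (2009)
[EtTh], §1, Prop. 1.4 (iii) p. 22 (values at non-cuspidal `K̈`-points), Prop. 1.5 p. 23 ("`log(Ü)`", the Kummer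
class of the coordinate `Ü`), Def. 1.9 p. 29 (the points `τ`, `τ⁻¹` with `Ü = √−1^{±1}`)
[cite: MochizukiEtTh2009, Prop 1.4 (iii) p.22]. Layer L2 of the abc-iut cell, seat abc-iut-L2-t6 (gen 6), R78
cluster hand #4, file map R100 **F7b part C** — over part A/B (`SettingModelChiSectionPoints`: the section Kummer
datum `kummerDataχSec`, `nonCuspidalPointχOfSection`), abc-iut-w5-d171's F6 (`kummerCoreχ`, `logUddχ = ` class of
`g ↦ c^{ŷ(g)/2}`, `half`, `yCoordχ`), abc-iut-L2-t5's F3c-2 (`kummerZH`, `kummerZH_mul`, `continuous_kummerZH`,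
`chiCocycle_mul`) and this seat's generic `KummerCore.anchoredPointOfSections` / `sectionPresentation` /
`toKddHatOfSection` (`KummerDataOfCoreSection`) — all consumed BY NAME, nothing restated.

WHAT. For a unit `u ∈ K̈^× = ℚ_p^×` of the χ-model let `κ_u : G_{ℚ_p} → Ẑ` be its Kummer cocycle for the
compatible root system `RootSystem.ofRootableBy u` (read in `Ẑ` through the cluster's `cycEquiv`), a continuous
`χ`-cocycle (`kappaUnitχ`, `kappaUnitχ_mul`, `continuous_kappaUnitχ`). The **`κ_u²`-twisted section**
`sectionOfUnitχ u := sectionχ (κ_u·κ_u) : σ ↦ ⟨b^{2κ_u(σ)}, σ⟩` (additively) is a continuous section of the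
augmentation inside `Π^tp_Ÿ`, and ALONG IT THE `y`-COORDINATE IS `κ_u²` (`yCoordχ_sectionOfUnitχ`). Hence the
core's `log(Ü) = ŷ/2` pulls back along `sectionOfUnitχ u` to the class of `σ ↦ c^{κ_u(σ)}` — which is exactly
the Kummer class `κ(u)` of the section datum presented through that section: the ANCHOR hypothesis `hanch` of
`KummerCore.anchoredPointOfSections` HOLDS (`comap_sectionOfUnitχ_logUdd`, on the nose at cocycle level). So
**`anchoredPointχ u hu : AnchoredPoint (kummerDataχSec p)`** for every `u` off the cusps: decomposition group
`sectionOfUnitχ u (G_{ℚ_p})`, coordinate `Ü(y) = u`, and `log(Ü)|_y` evaluates to `u`. CENSUS TOKEN (kernel):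
«AnchoredPoint → WITNESSED at modelχ» (`nonempty_anchoredPoint_modelχ`, with `u := 1 + p`); the points `τ^{±1}`
of Def. 1.9 are `anchoredPointχ (√−1)^{±1}` whenever `√−1 ∈ ℚ_p` (`p ≡ 1 (4)`) — their `MuTwoSetting`-level
packaging (`StandardData`) waits on a `MuTwoSetting` structure over `modelχ` (file-map gap (M)).

HONEST FRAMING: SEMI-SYNTHETIC model (the χ-twisted root; not the tempered `π₁` of a curve) — consistency /
non-vacuity evidence for the typed interface ONLY; nothing of [EtTh] is asserted; typed ≠ proved; no side is taken
on [IUTchIII] Cor. 3.12.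
-/

noncomputable section

namespace Literature.AnabelianGeometry.EtaleTheta.SettingModel

open Literature.AnabelianGeometry.SemiGraphs _root_.Topology _root_.Function

variable (p : ℕ) [Fact p.Prime]

/-! ### The Kummer cocycle `κ_u` of a unit `u ∈ K̈^× = ℚ_p^×` -/

/-- `G_K̈ = G_{ℚ_p}` at `modelχ` (`K̈ = ℚ_p(±1, ±p) = ℚ_p`). [cite: MochizukiEtTh2009, §1 p.17] -/
theorem fixingSubgroup_Kdd_modelχ : (ThetaSetting.modelχ p).Kdd.fixingSubgroup = ⊤ := by
  change (fieldKN ⊥ (qModel p) 2).fixingSubgroup = ⊤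
  rw [fieldKN_bot_qModel_two, IntermediateField.fixingSubgroup_bot]

/-- A unit `u ∈ K̈^×` of the χ-model read in `ℚ̄_p^×` (through the core's `toInvYdd`, so that the Kummer class of
the section datum unfolds to the SAME unit). [cite: MochizukiEtTh2009, Prop 1.5 p.23] -/
abbrev unitχ (u : (↥(ThetaSetting.modelχ p).Kdd)ˣ) : (PadicAlgCl p)ˣ :=
  (((kummerCoreχ p).toInvYdd u : (kummerCoreχ p).invYdd) : (PadicAlgCl p)ˣ)

/-- [cite: MochizukiEtTh2009, Prop 1.5 p.23] -/
theorem coe_unitχ (u : (↥(ThetaSetting.modelχ p).Kdd)ˣ) :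
    ((unitχ p u : (PadicAlgCl p)ˣ) : PadicAlgCl p) = ((u : (ThetaSetting.modelχ p).Kdd) : PadicAlgCl p) := rfl

/-- `u ∈ K̈^× = ℚ_p^×` is fixed by all of `G_{ℚ_p}`. [cite: MochizukiEtTh2009, §1 p.17] -/
theorem unitχ_mem_fixedPoints (u : (↥(ThetaSetting.modelχ p).Kdd)ˣ) :
    unitχ p u ∈ MulAction.fixedPoints (⊤ : Subgroup (GQp p)) (PadicAlgCl p)ˣ :=
  mem_fixedPoints_top_of_forall fun σ =>
    ThetaSetting.KummerCore.smul_eq_of_coe_mem (ThetaSetting.modelχ p).Kdd (unitχ p u)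
      (u : (ThetaSetting.modelχ p).Kdd).2 σ (by rw [fixingSubgroup_Kdd_modelχ]; exact Subgroup.mem_top σ)

/-- **`κ_u : G_{ℚ_p} → Ẑ`**, the Kummer cocycle of `u ∈ K̈^×` for the root system `RootSystem.ofRootableBy u`
(abc-iut-L2-t5's `kummerZH`). [cite: MochizukiEtTh2009, Prop 1.5 p.23] -/
def kappaUnitχ (u : (↥(ThetaSetting.modelχ p).Kdd)ˣ) : GQp p → ZH :=
  kummerZH (RootSystem.ofRootableBy (unitχ p u)) (unitχ_mem_fixedPoints p u)

/-- [cite: MochizukiEtTh2009, Prop 1.5 p.23] -/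
theorem kappaUnitχ_def (u : (↥(ThetaSetting.modelχ p).Kdd)ˣ) (σ : GQp p) :
    kappaUnitχ p u σ = kummerZH (RootSystem.ofRootableBy (unitχ p u)) (unitχ_mem_fixedPoints p u) σ := rfl

/-- `κ_u` is a `χ`-cocycle. [cite: MochizukiEtTh2009, Prop 1.5 p.23] -/
theorem kappaUnitχ_mul (u : (↥(ThetaSetting.modelχ p).Kdd)ˣ) (σ τ : GQp p) :
    kappaUnitχ p u (σ * τ) = kappaUnitχ p u σ * chi p σ (kappaUnitχ p u τ) :=
  kummerZH_mul _ _ σ τ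

/-- `κ_u²` is a `χ`-cocycle. [cite: MochizukiEtTh2009, Prop 1.5 p.23] -/
theorem kappaUnitχ_sq_mul (u : (↥(ThetaSetting.modelχ p).Kdd)ˣ) (σ τ : GQp p) :
    (kappaUnitχ p u * kappaUnitχ p u) (σ * τ) =
      (kappaUnitχ p u * kappaUnitχ p u) σ * chi p σ ((kappaUnitχ p u * kappaUnitχ p u) τ) :=
  chiCocycle_mul (kappaUnitχ_mul p u) (kappaUnitχ_mul p u) σ τ

/-- `κ_u` is continuous. [cite: MochizukiEtTh2009, Prop 1.5 p.23] -/
theorem continuous_kappaUnitχ (u : (↥(ThetaSetting.modelχ p).Kdd)ˣ) : Continuous (kappaUnitχ p u) :=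
  continuous_kummerZH p _ _

/-! ### The `κ_u²`-twisted section and its `y`-coordinate -/

/-- **The `κ_u²`-twisted Galois section** `σ ↦ ⟨b^{2κ_u(σ)}, σ⟩` (additively) — the decomposition group of the
`K̈`-point of `Ÿ` with `Ü = u`. [cite: MochizukiEtTh2009, Def 1.9 p.29] -/
def sectionOfUnitχ (u : (↥(ThetaSetting.modelχ p).Kdd)ˣ) : GQp p →* PiTpχ p :=
  sectionχ p (kappaUnitχ p u * kappaUnitχ p u) (kappaUnitχ_sq_mul p u)

/-- [cite: MochizukiEtTh2009, Def 1.9 p.29] -/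
theorem sectionOfUnitχ_def (u : (↥(ThetaSetting.modelχ p).Kdd)ˣ) :
    sectionOfUnitχ p u = sectionχ p (kappaUnitχ p u * kappaUnitχ p u) (kappaUnitχ_sq_mul p u) := rfl

/-- It is continuous. [cite: MochizukiEtTh2009, Def 1.9 p.29] -/
theorem continuous_sectionOfUnitχ (u : (↥(ThetaSetting.modelχ p).Kdd)ˣ) : Continuous (sectionOfUnitχ p u) :=
  continuous_sectionχ p _ _ ((continuous_kappaUnitχ p u).mul (continuous_kappaUnitχ p u))

/-- It is a section of the augmentation. [cite: MochizukiEtTh2009, Def 1.9 p.29] -/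
theorem aug_modelχ_sectionOfUnitχ (u : (↥(ThetaSetting.modelχ p).Kdd)ˣ) (σ : GQp p) :
    (ThetaSetting.modelχ p).aug (sectionOfUnitχ p u σ) = σ := rfl

/-- It lands in `Π^tp_Ÿ`. [cite: MochizukiEtTh2009, Def 1.9 p.29] -/
theorem map_sectionOfUnitχ_GKdd_le_GtpYdd (u : (↥(ThetaSetting.modelχ p).Kdd)ˣ) :
    (ThetaSetting.modelχ p).GKdd.map (sectionOfUnitχ p u) ≤ (ThetaSetting.modelχ p).GtpYdd :=
  map_sectionχ_sq_GKdd_le_GtpYdd_modelχ p (kappaUnitχ_mul p u) (kappaUnitχ_sq_mul p u)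

/-- **The `y`-coordinate along the twisted section is `κ_u²`**: `ŷ(⟨b^{2κ_u(σ)}, σ⟩) = κ_u(σ)·κ_u(σ)`.
[cite: MochizukiEtTh2009, Prop 1.5 p.23] -/
theorem yCoordχ_sectionOfUnitχ (u : (↥(ThetaSetting.modelχ p).Kdd)ˣ) (σ : GQp p) :
    yCoordχ p (sectionOfUnitχ p u σ) = kappaUnitχ p u σ * kappaUnitχ p u σ := by
  show eHatB (gfpFst (sectionχ p _ (kappaUnitχ_sq_mul p u) σ).left) = _
  rw [sectionχ_left, gfpFst_bPowGfp, eHatB_bPow]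
  rfl

/-- The same through the theta quotient: `ŷ(toTheta (s_u σ)) = κ_u(σ)²`. [cite: MochizukiEtTh2009, Prop 1.5 p.23] -/
theorem yThetaχ_toTheta_sectionOfUnitχ (u : (↥(ThetaSetting.modelχ p).Kdd)ˣ) (σ : GQp p) :
    yThetaχ p ((ThetaSetting.modelχ p).toTheta (sectionOfUnitχ p u σ)) = kappaUnitχ p u σ * kappaUnitχ p u σ :=
  yCoordχ_sectionOfUnitχ p u σ

/-- Halving the even class: `half(κ_u²) = κ_u`. [cite: MochizukiEtTh2009, Prop 1.5 p.23] -/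
theorem half_kappaUnitχ_sq (u : (↥(ThetaSetting.modelχ p).Kdd)ˣ) (σ : GQp p)
    (h : kappaUnitχ p u σ * kappaUnitχ p u σ ∈ sqHom.range) :
    half ⟨kappaUnitχ p u σ * kappaUnitχ p u σ, h⟩ = kappaUnitχ p u σ := by
  apply sqHom_injective
  rw [sqHom_apply, sqHom_apply, half_sq, pow_two]

/-! ### The anchor: `log(Ü)` pulled back along the twisted section is the Kummer class `κ(u)` -/

/-- **The ANCHOR hypothesis `hanch` HOLDS at the `κ_u²`-twisted section**: pulling the core's `log(Ü)` (class of
`g ↦ c^{ŷ(g)/2}`) back along `sectionOfUnitχ u` gives the pulled-back Kummer class `κ(u)` of the section datum,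
presented through `sectionOfUnitχ u` — ON THE NOSE at cocycle level: both are `σ ↦ c^{κ_u(σ)}`, since along the
section `ŷ/2 = κ_u` and the Kummer cocycle of the core at `toTheta(inr σ)` is `(σ(u^{1/N})/u^{1/N})_N`.
[cite: MochizukiEtTh2009, Prop 1.4 (iii) p.22] -/
theorem comap_sectionOfUnitχ_logUdd (u : (↥(ThetaSetting.modelχ p).Kdd)ˣ) :
    ContH1.comap (ThetaSetting.modelχ p).toTheta (ThetaSetting.modelχ p).DeltaTheta (sectionOfUnitχ p u)
        (continuous_sectionOfUnitχ p u) (map_sectionOfUnitχ_GKdd_le_GtpYdd p u)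
        ((ThetaSetting.modelχ p).inflTheta (ThetaSetting.modelχ p).GtpYdd (kummerCoreχ p).logUdd) =
      (kummerCoreχ p).sectionPresentation SemidirectProduct.inr (continuous_inr_modelχ p) (aug_modelχ_inr p)
        (map_inr_GK_le_GtpY_modelχ p) (map_inr_GKdd_le_GtpYdd_modelχ p) (sectionOfUnitχ p u)
        (aug_modelχ_sectionOfUnitχ p u)
        ((kummerCoreχ p).toKddHatOfSection SemidirectProduct.inr (continuous_inr_modelχ p)
          (map_inr_GKdd_le_GtpYdd_modelχ p) u) := by
  letI := (ThetaSetting.modelχ p).unitsAction (kummerCoreχ p).augTheta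
  change ContH1.mk _ _ = ContH1.mk _ _
  refine ContH1.mk_congr _ (funext fun x => ?_) _ _
  change deltaThetaCoordχ p (half ⟨yThetaχ p ((ThetaSetting.modelχ p).toTheta (sectionOfUnitχ p u x.1)), _⟩) =
    deltaThetaCoordχ p (cycEquiv p ((RootSystem.ofRootableBy (unitχ p u)).kummerCocycle _
      ⟨(ThetaSetting.modelχ p).toTheta (SemidirectProduct.inr x.1), _⟩))
  congr 1
  have hy : half ⟨yThetaχ p ((ThetaSetting.modelχ p).toTheta (sectionOfUnitχ p u x.1)), yThetaχ_mem_range_sqHom p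
      ⟨sectionOfUnitχ p u x.1, map_sectionOfUnitχ_GKdd_le_GtpYdd p u ⟨x.1, x.2, rfl⟩, rfl⟩⟩ = kappaUnitχ p u x.1 := by
    apply sqHom_injective
    rw [sqHom_apply, sqHom_apply, half_sq, pow_two]
    exact yThetaχ_toTheta_sectionOfUnitχ p u x.1
  rw [hy]
  -- `κ_u(σ) = e((σ(u^{1/N})/u^{1/N})_N)` and `augTheta (toTheta (inr σ)) = σ`, definitionally at the model
  rfl

/-! ### Anchored points of `Ÿ(K̈)` at `modelχ` -/

/-- **An ANCHORED `K̈`-point of `Ÿ` at `modelχ` with prescribed coordinate `u` off the cusps**: decomposition group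
the `κ_u²`-twisted section `sectionOfUnitχ u (G_{ℚ_p})`, `Ü(y) := u`, evaluation the pull-back along the section,
and the anchor `log(Ü)|_y = Ü(y)`. [cite: MochizukiEtTh2009, Prop 1.4 (iii) p.22] -/
def anchoredPointχ (u : (↥(ThetaSetting.modelχ p).Kdd)ˣ)
    (hu : ∀ a : ℤ, ((u : (ThetaSetting.modelχ p).Kdd) : PadicAlgCl p) ≠ (ThetaSetting.modelχ p).qdd ^ a ∧
      ((u : (ThetaSetting.modelχ p).Kdd) : PadicAlgCl p) ≠ -((ThetaSetting.modelχ p).qdd ^ a)) :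
    ThetaSetting.AnchoredPoint (kummerDataχSec p) :=
  (kummerCoreχ p).anchoredPointOfSections SemidirectProduct.inr (continuous_inr_modelχ p) (aug_modelχ_inr p)
    (map_inr_GK_le_GtpY_modelχ p) (map_inr_GKdd_le_GtpYdd_modelχ p) (sectionOfUnitχ p u)
    (continuous_sectionOfUnitχ p u) (aug_modelχ_sectionOfUnitχ p u) (map_sectionOfUnitχ_GKdd_le_GtpYdd p u) u hu
    (comap_sectionOfUnitχ_logUdd p u)

/-- Its decomposition group is `sectionOfUnitχ u (G_{ℚ_p})`. [cite: MochizukiEtTh2009, Prop 1.4 (iii) p.22] -/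
theorem Dpt_anchoredPointχ (u : (↥(ThetaSetting.modelχ p).Kdd)ˣ)
    (hu : ∀ a : ℤ, ((u : (ThetaSetting.modelχ p).Kdd) : PadicAlgCl p) ≠ (ThetaSetting.modelχ p).qdd ^ a ∧
      ((u : (ThetaSetting.modelχ p).Kdd) : PadicAlgCl p) ≠ -((ThetaSetting.modelχ p).qdd ^ a)) :
    (anchoredPointχ p u hu).Dpt = (ThetaSetting.modelχ p).GKdd.map (sectionOfUnitχ p u) := rfl

/-- Its coordinate is `u`. [cite: MochizukiEtTh2009, Prop 1.4 (iii) p.22] -/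
@[simp] theorem coord_anchoredPointχ (u : (↥(ThetaSetting.modelχ p).Kdd)ˣ)
    (hu : ∀ a : ℤ, ((u : (ThetaSetting.modelχ p).Kdd) : PadicAlgCl p) ≠ (ThetaSetting.modelχ p).qdd ^ a ∧
      ((u : (ThetaSetting.modelχ p).Kdd) : PadicAlgCl p) ≠ -((ThetaSetting.modelχ p).qdd ^ a)) :
    (anchoredPointχ p u hu).coord = u := rfl

/-- **CENSUS: `AnchoredPoint → WITNESSED at modelχ`** (for the section Kummer datum; coordinate `1 + p`).
[cite: MochizukiEtTh2009, Prop 1.4 (iii) p.22] -/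
theorem nonempty_anchoredPoint_modelχ : Nonempty (ThetaSetting.AnchoredPoint (kummerDataχSec p)) :=
  ⟨anchoredPointχ p (onePlusP p) (onePlusP_ne_cusp p)⟩

/-- All three E-indexed value rows of [EtTh] §1 are inhabited at ONE Kummer datum of `modelχ`.
[cite: MochizukiEtTh2009, Prop 1.4 (iii) p.22] -/
theorem exists_kummerData_nonempty_anchoredPoint_modelχ :
    ∃ E : (ThetaSetting.modelχ p).KummerData, Nonempty (ThetaSetting.NonCuspidalPoint E) ∧
      Nonempty (ThetaSetting.AnchoredPoint E) ∧ Nonempty (ThetaSetting.modelχ p).EtaleThetaData :=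
  ⟨kummerDataχSec p, nonempty_nonCuspidalPoint_modelχ p, nonempty_anchoredPoint_modelχ p,
    nonempty_etaleThetaData_modelχ p⟩

end Literature.AnabelianGeometry.EtaleTheta.SettingModel

end
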